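/-
Copyright (c) 2026. All rights reserved.
Released under Apache 2.0 license as described in the file LICENSE.
Authors: abc-iut cell, prover seat abc-iut-rp-x2 (branch B → R-H hand, gen 5).
-/
import Literature.IUT.LogVolume.UnitLogValuationProfileNoZeta
import Literature.IUT.LogVolume.UnitLogFirstTieLevelSphere
import HarnessLib

/-!
# The valuation profile of `log_p(𝒪_K^×)` at a TIE level: the envelope value IS ATTAINED when `f ≥ 2`
# (outer ties included; with or without `ζ_p ∈ K`)

Proof-only sequel (theorems, no definitions, no named fact) of abc-iut-rp-d4's `UnitLogValuationProfileNoZeta.lean`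
(under (NZ) «`−p` is not a `(p−1)`-th power to first order» the two tying terms never cancel) and of abc-iut-w6-d060's
`UnitLogFirstTieLevelSphere.lean` (at the FIRST tie `e = s·(p−1)` the sphere `‖z‖ = ‖ϖ‖ˢ` is met when `f ≥ 2`), consumed
BY NAME (`ValuationProfile.norm_logSeries_eq_zpow_of_two_dominant`, `….exponent_lower_of_tie`,
`….norm_pow_div_prime_eq_one_of_tie`; `BoundaryRamification.natCard_le_of_forall_addPoly_eq_zero`,
`….forall_addPoly_eq_zero_of_norm`).  Setting: `K` a proper ultrametric normed `ℚ_p`-algebra field (ANY prime `p`),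
`e = absRamificationIdx p K`, `f = residueDegree p K`, `ϖ` a norm uniformizer.

THE POINT (abc-iut GAP G-RH-anomaly1-2, «OUTER-TIE ATTAINMENT»).  At a TIE `e = s·p^{a₀}·(p−1)` of level `s` the two
terms of `L(y)` of indices `p^{a₀}`, `p^{a₀+1}` have the same norm `‖ϖ‖^{B}`, `B = s·p^{a₀} − e·a₀`, and their sum is the
first times the unit factor `1 + u`, `u = x^{p^{a₀}(p−1)}/p` (`x = 1 − y`).  Whether `B` is a value of `‖log_p(𝒪_K^×)‖`
is decided by the RESIDUE FIELD: writing `x = c·ϖˢ`, `u = w·c^{p^{a₀}(p−1)}` with the fixed unit `w = ϖᵉ/p`, and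
`c̄ ↦ 1 + w̄·(c̄^{p−1})^{p^{a₀}}` is CONSTANT on `k^×` only if `(k^×)^{p−1} = 1`, i.e. only if `#k = p`.  PROVED here:

* §1 `exists_norm_one_sub_pow_eq_one_of_two_le_residueDegree`: `f ≥ 2` ⇒ a unit `c` with `‖1 − c^{p−1}‖ = 1`
  (`c̄ ∉ 𝔽_p`: the additive polynomial `ā − āᵖ` cannot vanish on a field with more than `p` elements — w6-d060's
  counting lemma with `γ = −1`); `norm_pow_prime_pow_sub_one_eq_one`: `‖d − 1‖ = 1 ⇒ ‖d^{p^a} − 1‖ = 1`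
  (Mathlib `add_pow_prime_pow_eq`); hence `exists_norm_one_add_mul_pow_eq_one`: for EVERY unit `w` and every `a`
  some unit `c` has `‖1 + w·c^{p^a(p−1)}‖ = 1` (`c = 1` if `1 + w` is a unit, else the `c` of §1).
* §2 the (NZ)-free tie read-out: `norm_add_eq_of_tie_of_unit` / `norm_logSeries_eq_zpow_of_tie_of_unit` — rp-d4's
  `norm_add_eq_of_tie` / `norm_logSeries_eq_zpow_of_tie` with the hypothesis (NZ) replaced by the single unit
  condition `‖1 + x^{p^{a₀}(p−1)}/p‖ = 1` on the element at hand.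
* §3 **`exists_mem_logUnits_norm_eq_zpow_of_tie_of_two_le_residueDegree`**: `e = s·p^{a₀}·(p−1)` (`s ≥ 1`, ANY
  `a₀ ≥ 0`, any `p`), `f ≥ 2` ⇒ **some `z ∈ log_p(𝒪_K^×)` has `‖z‖ = ‖ϖ‖^{s·p^{a₀} − e·a₀}` EXACTLY** (`z = L(1 − c·ϖˢ)`);
  and the literal shape of the R-H gap statement `OuterTieAttained` (level `1`, `e = pᵃ·(p−1)`, `a ≥ 1`, `p` odd):
  **`outerTieAttained`** — `∃ z ∈ logUnits K, ‖z‖ = ‖ϖ‖^{pᵃ − a·e}`.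

So at an outer-tie place with `f_w ≥ 2` the OUTER radius of the R-H table is `r_out = B♯ = pᵃ − a·e` with or without
`ζ_p ∈ K_w` (record only: the HEX places over `p = l = 7`, `e_w = 42`, `4 ∣ f_w`, of row 15 «slotreach»).  Classical
`p`-adic analysis [cite: NeukirchANT1999, Ch. II Prop. (5.5)–(5.7)] [cite: Washington1997, §5.1]; nothing here is
disputed mathematics; no IUT statement is asserted; nothing bears on [IUTchIII] Cor. 3.12.
-/

noncomputable section

open Metric Set IsUltrametricDist IsLocalRing
open scoped Pointwise NormedField

namespace Literature.IUT.LogVolume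

namespace ValuationProfile

open Literature.NumberTheory.GaloisRepresentations.Ultrametric RamificationCriterion LogEnvelope
  BoundaryRamification

section Field

variable (p : ℕ) [hp : Fact p.Prime]
variable {K : Type*} [NontriviallyNormedField K] [instK : NormedAlgebra ℚ_[p] K] [IsUltrametricDist K]
  [ProperSpace K]

/-! ### §1. The residue field supplies a unit off `𝔽_p`, and the unit factor `1 + w·c^{p^a(p−1)}` -/

/-- **`f ≥ 2` ⇒ a unit `c` with `‖1 − c^{p−1}‖ = 1`** (i.e. `c̄ ∉ 𝔽_p`): otherwise `ā − āᵖ` would vanish on the whole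
residue field, which then has `≤ p` elements (abc-iut-w6-d060's `natCard_le_of_forall_addPoly_eq_zero` with `γ = −1`),
contradicting `#k = p^f ≥ p²`. [cite: Washington1997, §5.1] -/
theorem exists_norm_one_sub_pow_eq_one_of_two_le_residueDegree (hf : 2 ≤ residueDegree p K) :
    ∃ c : K, ‖c‖ = 1 ∧ ‖1 - c ^ (p - 1)‖ = 1 := by
  have hn1 : ‖((-1 : K))‖ = 1 := by rw [norm_neg, norm_one]
  let C : Valued.integer K := ⟨-1, Valued.integer.mem_iff.mpr hn1.le⟩
  haveI := charP_residueField p K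
  haveI : Finite (ResidueField (Valued.integer K)) := finite_residueField
  -- some integral `a` has `a − aᵖ` a unit
  have hex : ∃ a : K, ‖a‖ ≤ 1 ∧ ‖a + (C : K) * a ^ p‖ = 1 := by
    by_contra hnone
    push Not at hnone
    have hK : ∀ a : K, ‖a‖ ≤ 1 → ‖a + (C : K) * a ^ p‖ < 1 := by
      intro a ha
      have hle : ‖a + (C : K) * a ^ p‖ ≤ 1 := by
        refine (norm_add_le_max _ _).trans (max_le ha ?_)
        rw [norm_mul, show ((C : Valued.integer K) : K) = -1 from rfl, hn1, one_mul, norm_pow]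
        exact pow_le_one₀ (norm_nonneg _) ha
      exact lt_of_le_of_ne hle (hnone a ha)
    have h0 := forall_addPoly_eq_zero_of_norm p C hK
    have hγ : residue (Valued.integer K) C ≠ 0 := residue_ne_zero_of_norm_eq_one C hn1
    have hle := natCard_le_of_forall_addPoly_eq_zero p hγ h0
    rw [card_residueField p K] at hle
    have h2 : p ^ 2 ≤ p ^ residueDegree p K := Nat.pow_le_pow_right hp.out.pos hf
    have hlt : p < p ^ 2 := by rw [pow_two]; exact lt_mul_self hp.out.one_lt
    omega
  obtain ⟨a, ha, hΛ⟩ := hex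
  have hCa : a + (C : K) * a ^ p = a * (1 - a ^ (p - 1)) := by
    rw [show ((C : Valued.integer K) : K) = -1 from rfl,
      show a ^ p = a * a ^ (p - 1) from by rw [← pow_succ', Nat.sub_add_cancel hp.out.one_le]]
    ring
  rw [hCa, norm_mul] at hΛ
  have h1 : ‖1 - a ^ (p - 1)‖ ≤ 1 := by
    have h := norm_add_le_max (1 : K) (-(a ^ (p - 1)))
    rw [← sub_eq_add_neg, norm_one, norm_neg, norm_pow] at h
    exact h.trans (max_le le_rfl (pow_le_one₀ (norm_nonneg _) ha))
  refine ⟨a, le_antisymm ha ?_, le_antisymm h1 ?_⟩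
  · have h := mul_le_mul_of_nonneg_left h1 (norm_nonneg a)
    rw [hΛ, mul_one] at h
    exact h
  · have h := mul_le_mul_of_nonneg_right ha (norm_nonneg (1 - a ^ (p - 1)))
    rw [hΛ, one_mul] at h
    exact h

omit [ProperSpace K] in
/-- **`‖d − 1‖ = 1 ⇒ ‖d^{p^a} − 1‖ = 1`**: `d^{p^a} = (d − 1)^{p^a} + 1 + p·(d−1)·(integer)` (Mathlib
`add_pow_prime_pow_eq`), and `‖p·…‖ < 1 = ‖(d−1)^{p^a}‖`. [cite: NeukirchANT1999, Ch. II Prop. (5.5)] -/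
theorem norm_pow_prime_pow_sub_one_eq_one {d : K} (hd1 : ‖d - 1‖ = 1) (a : ℕ) :
    ‖d ^ (p ^ a) - 1‖ = 1 := by
  set δ : K := d - 1 with hδ_def
  have hδ1 : ‖δ‖ ≤ 1 := hd1.le
  set S : K := ∑ k ∈ Finset.Ioo 0 (p ^ a), δ ^ (k - 1) * (1 : K) ^ (p ^ a - k - 1) * (((p ^ a).choose k / p : ℕ) : K)
    with hS_def
  have hS : ‖S‖ ≤ 1 := by
    refine IsUltrametricDist.norm_sum_le_of_forall_le_of_nonneg zero_le_one fun k _ => ?_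
    rw [norm_mul, norm_mul, norm_pow, one_pow, norm_one, mul_one]
    exact mul_le_one₀ (pow_le_one₀ (norm_nonneg _) hδ1) (norm_nonneg _)
      (IsUltrametricDist.norm_natCast_le_one K _)
  have key : d ^ (p ^ a) - 1 = δ ^ (p ^ a) + (p : K) * δ * S := by
    have h := add_pow_prime_pow_eq hp.out δ 1 a
    rw [hS_def]
    rw [show d = δ + 1 from by rw [hδ_def]; ring, h, one_pow]
    ring
  have hmain : ‖δ ^ (p ^ a)‖ = 1 := by rw [norm_pow, hd1, one_pow]
  have hsmall : ‖(p : K) * δ * S‖ < ‖δ ^ (p ^ a)‖ := by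
    rw [hmain, norm_mul, norm_mul]
    calc ‖(p : K)‖ * ‖δ‖ * ‖S‖ ≤ ‖(p : K)‖ * 1 * 1 := by gcongr
      _ = ‖(p : K)‖ := by ring
      _ < 1 := norm_prime_lt_one p K
  rw [key, IsUltrametricDist.norm_add_eq_max_of_norm_ne_norm (ne_of_gt hsmall), max_eq_left hsmall.le, hmain]

/-- **The unit factor can be made a unit**: for every unit `w` and every `a` there is a unit `c` with
`‖1 + w·c^{p^a·(p−1)}‖ = 1` — `c = 1` if `1 + w` is a unit; otherwise (`w̄ = −1`) any `c` with `c̄ ∉ 𝔽_p` (§1, `f ≥ 2`):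
`1 + w·c^{p^a(p−1)} = (1 + w) + w·((c^{p−1})^{p^a} − 1)` with the last term a unit. [cite: Washington1997, §5.1] -/
theorem exists_norm_one_add_mul_pow_eq_one (hf : 2 ≤ residueDegree p K) {w : K} (hw : ‖w‖ = 1) (a : ℕ) :
    ∃ c : K, ‖c‖ = 1 ∧ ‖1 + w * c ^ (p ^ a * (p - 1))‖ = 1 := by
  by_cases h1w : ‖1 + w‖ = 1
  · exact ⟨1, norm_one, by rw [one_pow, mul_one]; exact h1w⟩
  have hlt : ‖1 + w‖ < 1 := by
    refine lt_of_le_of_ne ((norm_add_le_max _ _).trans ?_) h1w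
    rw [norm_one, hw, max_self]
  obtain ⟨c, hc, hc1⟩ := exists_norm_one_sub_pow_eq_one_of_two_le_residueDegree p hf
  refine ⟨c, hc, ?_⟩
  have hd1 : ‖c ^ (p - 1) - 1‖ = 1 := by rw [← norm_neg, neg_sub]; exact hc1
  have hunit := norm_pow_prime_pow_sub_one_eq_one p hd1 a
  have hsplit : 1 + w * c ^ (p ^ a * (p - 1)) = w * ((c ^ (p - 1)) ^ (p ^ a) - 1) + (1 + w) := by
    rw [← pow_mul, mul_comm (p - 1)]
    ring
  have hbig : ‖w * ((c ^ (p - 1)) ^ (p ^ a) - 1)‖ = 1 := by rw [norm_mul, hw, hunit, one_mul]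
  have hne : ‖w * ((c ^ (p - 1)) ^ (p ^ a) - 1)‖ ≠ ‖1 + w‖ := by rw [hbig]; exact (ne_of_lt hlt).symm
  rw [hsplit, IsUltrametricDist.norm_add_eq_max_of_norm_ne_norm hne, hbig, max_eq_left hlt.le]

/-! ### §2. The tie read-out with the unit condition in place of (NZ) -/

/-- **Sum of the two tying terms, (NZ)-free.**  `x = 1 − y`, `‖x‖ = ‖ϖ‖ˢ` (at a tie `e = s·p^{a₀}·(p−1)`), indices
`n₀ + 1 = p^{a₀}`, `n₁ + 1 = p^{a₀+1}`, and `‖1 + x^{p^{a₀}(p−1)}/p‖ = 1` ⇒ the two terms sum to an element of norm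
EXACTLY `‖ϖ‖^{s·p^{a₀} − e·a₀}` (rp-d4's `norm_add_eq_of_tie` with (NZ) replaced by the unit condition on the element).
[cite: NeukirchANT1999, Ch. II Prop. (5.5)] -/
theorem norm_add_eq_of_tie_of_unit {ϖ : Kˣ} (hϖ : IsUniformizer ϖ) {y : K} {s : ℤ}
    (hy : ‖1 - y‖ = ‖(ϖ : K)‖ ^ s) {a₀ : ℕ} {n₀ n₁ : ℕ} (hn₀ : n₀ + 1 = p ^ a₀)
    (hn₁ : n₁ + 1 = p ^ (a₀ + 1)) (hunit : ‖1 + (1 - y) ^ (p ^ a₀ * (p - 1)) / (p : K)‖ = 1) :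
    ‖-((1 - y) ^ (n₀ + 1)) / (n₀ + 1 : K) + -((1 - y) ^ (n₁ + 1)) / (n₁ + 1 : K)‖ =
      ‖(ϖ : K)‖ ^ (s * (p : ℤ) ^ a₀ - (absRamificationIdx p K : ℤ) * (a₀ : ℤ)) := by
  have hp0 : (p : K) ≠ 0 := prime_ne_zero p K
  have hT₀ : ‖-((1 - y) ^ (n₀ + 1)) / (n₀ + 1 : K)‖ =
      ‖(ϖ : K)‖ ^ (s * (p : ℤ) ^ a₀ - (absRamificationIdx p K : ℤ) * (a₀ : ℤ)) := by
    rw [norm_logTerm_eq_zpow p hϖ hy n₀, hn₀, padicValNat.prime_pow]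
    push_cast
    ring_nf
  have hcast₀ : ((n₀ : K) + 1) = (p : K) ^ a₀ := by rw [← Nat.cast_pow, ← hn₀, Nat.cast_succ]
  have hcast₁ : ((n₁ : K) + 1) = (p : K) ^ (a₀ + 1) := by rw [← Nat.cast_pow, ← hn₁, Nat.cast_succ]
  have hp1 : 1 ≤ p := hp.out.one_le
  have hfac : -((1 - y) ^ (n₀ + 1)) / (n₀ + 1 : K) + -((1 - y) ^ (n₁ + 1)) / (n₁ + 1 : K) =
      (-((1 - y) ^ (n₀ + 1)) / (n₀ + 1 : K)) * (1 + (1 - y) ^ (p ^ a₀ * (p - 1)) / (p : K)) := by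
    rw [hcast₀, hcast₁, hn₀, hn₁]
    have hexp : p ^ (a₀ + 1) = p ^ a₀ * (p - 1) + p ^ a₀ := by
      rw [pow_succ, ← Nat.mul_add_one, Nat.sub_add_cancel hp1]
    rw [hexp, pow_add, pow_succ, pow_mul]
    field_simp
    ring
  rw [hfac, norm_mul, hunit, mul_one, hT₀]

/-- **Exact norm at a TIE, (NZ)-free**: `‖1 − y‖ = ‖ϖ‖ˢ` (`y` principal), `s·pᵃ·(p−1) < e` for `a < a₀`,
`e = s·p^{a₀}·(p−1)`, and `‖1 + (1−y)^{p^{a₀}(p−1)}/p‖ = 1` ⟹ `‖L(y)‖ = ‖ϖ‖^{s·p^{a₀} − e·a₀}` (two dominant terms;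
rp-d4's `exponent_lower_of_tie` for all other indices). [cite: NeukirchANT1999, Ch. II Prop. (5.5)] -/
theorem norm_logSeries_eq_zpow_of_tie_of_unit {ϖ : Kˣ} (hϖ : IsUniformizer ϖ) {y : K} (hyP : IsPrincipal y)
    {s : ℤ} (hy : ‖1 - y‖ = ‖(ϖ : K)‖ ^ s) {a₀ : ℕ}
    (hlo : ∀ a < a₀, s * (p : ℤ) ^ a * ((p : ℤ) - 1) < absRamificationIdx p K)
    (htie : (absRamificationIdx p K : ℤ) = s * (p : ℤ) ^ a₀ * ((p : ℤ) - 1))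
    (hunit : ‖1 + (1 - y) ^ (p ^ a₀ * (p - 1)) / (p : K)‖ = 1) :
    ‖logSeries y‖ = ‖(ϖ : K)‖ ^ (s * (p : ℤ) ^ a₀ - (absRamificationIdx p K : ℤ) * (a₀ : ℤ)) := by
  classical
  have hρ0 : 0 < ‖(ϖ : K)‖ := norm_units_pos ϖ
  have hs1 : 1 ≤ s := by
    have h1 : ‖(ϖ : K)‖ ^ s < 1 := hy ▸ hyP
    have := (zpow_lt_one_iff_right_of_lt_one₀ hρ0 hϖ.1).mp h1
    omega
  have hE : (1 : ℤ) ≤ (absRamificationIdx p K : ℤ) := by exact_mod_cast absRamificationIdx_pos p K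
  obtain ⟨n₀, hn₀⟩ : ∃ n₀ : ℕ, n₀ + 1 = p ^ a₀ := ⟨p ^ a₀ - 1, Nat.sub_add_cancel (Nat.one_le_pow _ _ hp.out.pos)⟩
  obtain ⟨n₁, hn₁⟩ : ∃ n₁ : ℕ, n₁ + 1 = p ^ (a₀ + 1) :=
    ⟨p ^ (a₀ + 1) - 1, Nat.sub_add_cancel (Nat.one_le_pow _ _ hp.out.pos)⟩
  have hne : n₀ ≠ n₁ := by
    intro h
    have : p ^ a₀ = p ^ (a₀ + 1) := by rw [← hn₀, ← hn₁, h]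
    exact absurd (Nat.pow_right_injective hp.out.two_le this) (by omega)
  refine norm_logSeries_eq_zpow_of_two_dominant p hϖ hyP hy hne
    (norm_add_eq_of_tie_of_unit p hϖ hy hn₀ hn₁ hunit) ?_
  intro n hn0 hn1
  obtain ⟨a, ha, ha'⟩ := exists_exponent_le_index (p := p) hs1 (absRamificationIdx p K) (Nat.succ_ne_zero n)
  by_cases haa : a = a₀
  · have hne' : n + 1 ≠ p ^ a := by rw [haa, ← hn₀]; intro h; exact hn0 (by omega)
    have := ha' hne'
    rw [haa] at this
    exact this
  by_cases haa' : a = a₀ + 1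
  · have hne' : n + 1 ≠ p ^ a := by rw [haa', ← hn₁]; intro h; exact hn1 (by omega)
    have h2 := ha' hne'
    have h01 := exponent_succ_sub s (p : ℤ) (absRamificationIdx p K : ℤ) a₀
    rw [haa'] at h2
    have : s * (p : ℤ) ^ a₀ * ((p : ℤ) - 1) - (absRamificationIdx p K : ℤ) = 0 := by rw [htie]; ring
    push_cast at h01 h2 ⊢
    linarith
  · exact (exponent_lower_of_tie p hs1 hE hlo htie haa haa').trans ha

/-! ### §3. Attainment at a tie when `f ≥ 2` -/

/-- **THE ENVELOPE VALUE AT A TIE IS ATTAINED when `f ≥ 2`** (any prime `p`, any level `s ≥ 1`, any tie position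
`a₀ ≥ 0`, with or without `ζ_p ∈ K`): if `e = s·p^{a₀}·(p−1)` and `residueDegree ≥ 2`, some `z ∈ log_p(𝒪_K^×)` has
`‖z‖ = ‖ϖ‖^{s·p^{a₀} − e·a₀}` EXACTLY — namely `z = L(1 − c·ϖˢ)` with `c` the unit of §1 for `w = (ϖˢ)^{p^{a₀}(p−1)}/p`.
[cite: NeukirchANT1999, Ch. II Prop. (5.5)] [cite: Washington1997, §5.1] -/
theorem exists_mem_logUnits_norm_eq_zpow_of_tie_of_two_le_residueDegree {ϖ : Kˣ} (hϖ : IsUniformizer ϖ)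
    {s : ℕ} (hs : 1 ≤ s) {a₀ : ℕ} (he : absRamificationIdx p K = s * p ^ a₀ * (p - 1))
    (hf : 2 ≤ residueDegree p K) :
    ∃ z ∈ logUnits K, ‖z‖ = ‖(ϖ : K)‖ ^ ((s : ℤ) * (p : ℤ) ^ a₀ - (absRamificationIdx p K : ℤ) * (a₀ : ℤ)) := by
  have hρ0 : 0 < ‖(ϖ : K)‖ := norm_units_pos ϖ
  have hρ1 : ‖(ϖ : K)‖ < 1 := hϖ.1
  have htie : (absRamificationIdx p K : ℤ) = (s : ℤ) * (p : ℤ) ^ a₀ * ((p : ℤ) - 1) := by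
    rw [he]; push_cast [Nat.cast_sub hp.out.one_le]; ring
  have hxs : ‖(ϖ : K) ^ s‖ = ‖(ϖ : K)‖ ^ (s : ℤ) := by rw [norm_pow, zpow_natCast]
  -- the fixed unit `w = (ϖˢ)^{p^{a₀}(p−1)}/p`
  have hw : ‖((ϖ : K) ^ s) ^ (p ^ a₀ * (p - 1)) / (p : K)‖ = 1 := norm_pow_div_prime_eq_one_of_tie p hϖ hxs htie
  obtain ⟨c, hc, hcu⟩ := exists_norm_one_add_mul_pow_eq_one p hf hw a₀
  -- the principal unit `y = 1 − c·ϖˢ` of level `s`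
  set y : K := 1 - c * (ϖ : K) ^ s with hy_def
  have hx : (1 : K) - y = c * (ϖ : K) ^ s := by rw [hy_def]; ring
  have hy : ‖1 - y‖ = ‖(ϖ : K)‖ ^ (s : ℤ) := by rw [hx, norm_mul, hc, one_mul, hxs]
  have hyP : IsPrincipal y := by
    show ‖1 - y‖ < 1
    rw [hy]
    exact (zpow_lt_one_iff_right_of_lt_one₀ hρ0 hρ1).mpr (by exact_mod_cast hs)
  have hunit : ‖1 + (1 - y) ^ (p ^ a₀ * (p - 1)) / (p : K)‖ = 1 := by
    rw [hx, mul_pow, show c ^ (p ^ a₀ * (p - 1)) * ((ϖ : K) ^ s) ^ (p ^ a₀ * (p - 1)) / (p : K)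
      = ((ϖ : K) ^ s) ^ (p ^ a₀ * (p - 1)) / (p : K) * c ^ (p ^ a₀ * (p - 1)) from by ring]
    exact hcu
  have hlo : ∀ a < a₀, (s : ℤ) * (p : ℤ) ^ a * ((p : ℤ) - 1) < absRamificationIdx p K := by
    intro a ha
    rw [htie]
    have hP : (2 : ℤ) ≤ (p : ℤ) := by exact_mod_cast hp.out.two_le
    have hpow : (p : ℤ) ^ a < (p : ℤ) ^ a₀ := pow_lt_pow_right₀ (by linarith) ha
    have hs' : (0 : ℤ) < (s : ℤ) := by exact_mod_cast hs
    have h1 : (0 : ℤ) < (p : ℤ) - 1 := by linarith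
    nlinarith [mul_pos hs' h1]
  refine ⟨logSeries y, ?_, norm_logSeries_eq_zpow_of_tie_of_unit p hϖ hyP hy hlo htie hunit⟩
  rw [← unitLog_of_isPrincipal p hyP]
  exact unitLog_mem_logUnits hyP.norm_eq_one

/-- **OUTER-TIE ATTAINMENT** (the abc-iut R-H gap statement `OuterTieAttained`, literal shape; level `1`):
`e = pᵃ·(p−1)`, `a ≥ 1`, `p` odd, `residueDegree ≥ 2` ⟹ `∃ z ∈ log_p(𝒪_K^×), ‖z‖ = ‖ϖ‖^{pᵃ − a·e}` — the outer radius
`r_out = B♯` is attained with or without `ζ_p ∈ K`. (`a ≥ 1` and `p ≠ 2` are not used.)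
[cite: NeukirchANT1999, Ch. II Prop. (5.5)–(5.7)] [cite: Washington1997, §5.1] -/
theorem outerTieAttained {ϖ : Kˣ} (hϖ : IsUniformizer ϖ) {a : ℕ} (_ha : 1 ≤ a) (_hp2 : p ≠ 2)
    (he : absRamificationIdx p K = p ^ a * (p - 1)) (hf : 2 ≤ residueDegree p K) :
    ∃ z ∈ logUnits K, ‖z‖ = ‖(ϖ : K)‖ ^ ((p : ℤ) ^ a - (a : ℤ) * (absRamificationIdx p K : ℤ)) := by
  obtain ⟨z, hz, hzn⟩ := exists_mem_logUnits_norm_eq_zpow_of_tie_of_two_le_residueDegree p hϖ (s := 1) le_rfl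
    (a₀ := a) (by rw [he, one_mul]) hf
  refine ⟨z, hz, ?_⟩
  rw [hzn]
  congr 1
  push_cast
  ring

end Field

end ValuationProfile

end Literature.IUT.LogVolume

end
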